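import Literature.Probability.Percolation.KozmaNitzanPreFKG
import HarnessLib

/-!
# Crux `PercNearOneGluing.AdditiveGluing` (stmt-CriticalPhenomena-4576): the mixture (entrance) form of the multiplicative Lemma 4

Support file (`--supports stmt-CriticalPhenomena-4576`, lead png-lead-4576 / rtask e8780df7).  No definitions, no named
facts, no sorries.  Companion of `PercNearOneGluingAdditiveGluingKnLemma4Mult` (`knLemma4Mult`).

With `h(x) = μ(x ↔ b)`, `e = {a₁, a₂}`, `Gain_x(e) = μ({x ↮ b} ∩ ({x ↔ a₁} ∩ {a₂ ↔ b} ∪ {x ↔ a₂} ∩ {a₁ ↔ b}))`,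
`D = {a₁ ↮ a₂}`, `A_k = μ(D ∩ {o ↔ a_k})`, `π₁₂ = μ(a₁ ↮ b, a₂ ↔ b) = Gain_{a₁}(e)`, `π₂₁ = Gain_{a₂}(e)`:

  **`(A₁·h(a₁) + A₂·h(a₂)) · Gain_o(e) ≤ (A₁·π₁₂ + A₂·π₂₁) · h(o)`**  (`knLemma4Mult_mixture`, no hypothesis on `h(a₁), h(a₂)`).

Dividing by `h(o)·(A₁h(a₁)+A₂h(a₂))`: the normalised gain `Gain_o/h(o)` of any observer is dominated by the mixture of the
endpoints' normalised gains `πᵢⱼ/h(aᵢ)` with weights `∝ A_k h(a_k)` ("attach to `a_k` given separation, then `a_k` succeeds") —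
the percolation analogue of the entrance decomposition of a Markov chain, and the `|R| = 2` case of the mixture-domination form of
the conjectured log-derivative monotonicity MGEN (lead memo LeadMath-rtask1).  `knLemma4Mult` is the corollary "mixture ≤ max".
Proof: BHK Thm 1.4 twice gives `μ(D)·Gain_o ≤ A₁π₁₂ + A₂π₂₁`; BHK Thm 1.3 twice and Harris twice give
`A₁h(a₁) + A₂h(a₂) ≤ μ(D)·h(o)`; multiply.
[cite: KozmaNitzan2024, Theorem 1 (pp. 7–8), Lemma 4 / eq. (9) (pp. 9–10); VandenbergHaggstromKahn2005, Thms. 1.3–1.4 (pp. 6–7)]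
-/

namespace Summit.CriticalPhenomena.PercolationContinuityZ3.Theorems

open MeasureTheory Set Literature.Probability.LatticeModels Literature.Probability.Percolation
open Literature.Probability.Percolation.KNPreFKG

noncomputable section
open Classical

variable {V : Type*} [Fintype V]

/-- **Mixture (entrance) form of the multiplicative Lemma 4** (hypothesis-free, sharper than `knLemma4Mult`):
with `D = {a₁ ↮ a₂}` and the unnormalised attachments `A_k = μ(D ∩ {o ↔ a_k})`,
`(A₁·h(a₁) + A₂·h(a₂)) · Gain_o({a₁,a₂}) ≤ (A₁·π₁₂ + A₂·π₂₁) · h(o)`, `π₁₂ = μ(a₁↮b, a₂↔b) = Gain_{a₁}`,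
`π₂₁ = Gain_{a₂}`: o's normalised gain is dominated by the `A_k h(a_k)`-mixture of the endpoints' normalised gains — the
percolation analogue of the Markov-chain entrance decomposition.  Same four BHK steps and two Harris steps as `knLemma4Mult`.
[cite: KozmaNitzan2024, Theorem 1 (pp. 7–8), Lemma 4 (p. 9); VandenbergHaggstromKahn2005, Thm. 1.3 (p. 6), Thm. 1.4 (p. 7)] -/
theorem knLemma4Mult_mixture (w : Sym2 V → unitInterval) (o b a₁ a₂ : V) :
    ((prodBernoulli w).real ({ω : BondConfig V | ¬ (openGraph ω).Reachable a₁ a₂} ∩ openConn o a₁) *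
          (prodBernoulli w).real (openConn a₁ b) +
        (prodBernoulli w).real ({ω : BondConfig V | ¬ (openGraph ω).Reachable a₁ a₂} ∩ openConn o a₂) *
          (prodBernoulli w).real (openConn a₂ b)) *
        (prodBernoulli w).real ((openConn o b)ᶜ ∩ (openConn o a₁ ∩ openConn a₂ b ∪ openConn o a₂ ∩ openConn a₁ b)) ≤
      ((prodBernoulli w).real ({ω : BondConfig V | ¬ (openGraph ω).Reachable a₁ a₂} ∩ openConn o a₁) *
          (prodBernoulli w).real ((openConn a₁ b)ᶜ ∩ openConn a₂ b) +
        (prodBernoulli w).real ({ω : BondConfig V | ¬ (openGraph ω).Reachable a₁ a₂} ∩ openConn o a₂) *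
          (prodBernoulli w).real ((openConn a₂ b)ᶜ ∩ openConn a₁ b)) *
        (prodBernoulli w).real (openConn o b) := by
  set μ := prodBernoulli w with hμ
  have hm : ∀ s : Set (BondConfig V), MeasurableSet s := fun _ => MeasurableSet.of_discrete
  have hsplit : ∀ A S : Set (BondConfig V), μ.real A = μ.real (A ∩ S) + μ.real (A ∩ Sᶜ) := by
    intro A S
    rw [← measureReal_inter_add_sdiff (s := A) (hm S), Set.sdiff_eq]
  by_cases h12eq : a₁ = a₂
  · -- degenerate pair: the gain event forces `o ↔ b`, so it is empty
    subst h12eq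
    have hG : ((openConn o b)ᶜ ∩ (openConn o a₁ ∩ openConn a₁ b ∪ openConn o a₁ ∩ openConn a₁ b) :
        Set (BondConfig V)) = ∅ := by
      ext ω
      simp only [mem_inter_iff, mem_compl_iff, mem_union, openConn, mem_setOf_eq, mem_empty_iff_false, iff_false,
        not_and]
      intro hob h
      rcases h with ⟨h1, hb⟩ | ⟨h1, hb⟩ <;> exact hob (h1.trans hb)
    rw [hG, measureReal_empty, mul_zero]
    exact mul_nonneg (add_nonneg (mul_nonneg measureReal_nonneg measureReal_nonneg)
      (mul_nonneg measureReal_nonneg measureReal_nonneg)) measureReal_nonneg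
  set O₁ : Set (BondConfig V) := openConn o a₁ with hO₁
  set O₂ : Set (BondConfig V) := openConn o a₂ with hO₂
  set Ob : Set (BondConfig V) := openConn o b with hOb
  set B₁ : Set (BondConfig V) := openConn a₁ b with hB₁
  set B₂ : Set (BondConfig V) := openConn a₂ b with hB₂
  set D : Set (BondConfig V) := {ω | ¬ (openGraph ω).Reachable a₁ a₂} with hD
  -- the gain event splits along `D` into the two crossed two-cluster events
  have hGain : (Obᶜ ∩ (O₁ ∩ B₂ ∪ O₂ ∩ B₁)) = (O₁ ∩ B₂ ∩ D) ∪ (O₂ ∩ B₁ ∩ D) := by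
    ext ω
    simp only [mem_inter_iff, mem_compl_iff, mem_union, hO₁, hO₂, hOb, hB₁, hB₂, hD, openConn, mem_setOf_eq]
    constructor
    · rintro ⟨hob, ⟨h1, hb2⟩ | ⟨h2, hb1⟩⟩
      · exact Or.inl ⟨⟨h1, hb2⟩, fun h => hob ((h1.trans h).trans hb2)⟩
      · exact Or.inr ⟨⟨h2, hb1⟩, fun h => hob ((h2.trans h.symm).trans hb1)⟩
    · rintro (⟨⟨h1, hb2⟩, hn⟩ | ⟨⟨h2, hb1⟩, hn⟩)
      · exact ⟨fun hob => hn ((h1.symm.trans hob).trans hb2.symm), Or.inl ⟨h1, hb2⟩⟩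
      · exact ⟨fun hob => hn ((hb1.trans hob.symm).trans h2), Or.inr ⟨h2, hb1⟩⟩
  have hdisj : Disjoint (O₁ ∩ B₂ ∩ D) (O₂ ∩ B₁ ∩ D) := by
    rw [Set.disjoint_left]
    rintro ω ⟨⟨h1, _⟩, hn⟩ ⟨⟨h2, _⟩, _⟩
    exact hn (h1.symm.trans h2)
  have hGain_eq : μ.real (Obᶜ ∩ (O₁ ∩ B₂ ∪ O₂ ∩ B₁)) = μ.real (O₁ ∩ B₂ ∩ D) + μ.real (O₂ ∩ B₁ ∩ D) := by
    rw [hGain, measureReal_union hdisj (hm _)]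
  -- `π₁ = μ(B₁ᶜ ∩ B₂) = μ(D ∩ B₂)`, `π₂ = μ(D ∩ B₁)`, `θ₁ = π₂ + c`, `θ₂ = π₁ + c`
  have hpi1 : (B₁ᶜ ∩ B₂) = D ∩ B₂ := by
    ext ω
    simp only [mem_inter_iff, mem_compl_iff, hB₁, hB₂, hD, openConn, mem_setOf_eq]
    constructor
    · rintro ⟨hn1, hb2⟩
      exact ⟨fun h => hn1 (h.trans hb2), hb2⟩
    · rintro ⟨hn, hb2⟩
      exact ⟨fun hb1 => hn (hb1.trans hb2.symm), hb2⟩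
  have hpi2 : (B₁ ∩ B₂ᶜ) = D ∩ B₁ := by
    ext ω
    simp only [mem_inter_iff, mem_compl_iff, hB₁, hB₂, hD, openConn, mem_setOf_eq]
    constructor
    · rintro ⟨hb1, hn2⟩
      exact ⟨fun h => hn2 (h.symm.trans hb1), hb1⟩
    · rintro ⟨hn, hb1⟩
      exact ⟨hb1, fun hb2 => hn (hb1.trans hb2.symm)⟩
  have hθ1 : μ.real B₁ = μ.real (D ∩ B₁) + μ.real (B₁ ∩ B₂) := by
    rw [hsplit B₁ B₂, hpi2]; ring
  have hθ2 : μ.real B₂ = μ.real (D ∩ B₂) + μ.real (B₁ ∩ B₂) := by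
    rw [hsplit B₂ B₁, show B₂ ∩ B₁ = B₁ ∩ B₂ from inter_comm _ _, show B₂ ∩ B₁ᶜ = B₁ᶜ ∩ B₂ from inter_comm _ _, hpi1]
    ring
  -- three disjoint pieces of `{o ↔ b}`
  have hS1 : O₁ ∩ B₁ ∩ D ⊆ Ob := by
    rintro ω ⟨⟨h1, hb⟩, _⟩; exact h1.trans hb
  have hS2 : O₂ ∩ B₂ ∩ D ⊆ Ob := by
    rintro ω ⟨⟨h2, hb⟩, _⟩; exact h2.trans hb
  have hS3 : (O₁ ∪ O₂) ∩ (B₁ ∩ B₂) ⊆ Ob := by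
    rintro ω ⟨h1 | h2, ⟨hb1, hb2⟩⟩
    · exact h1.trans hb1
    · exact h2.trans hb2
  have hOb_ge : μ.real (O₁ ∩ B₁ ∩ D) + μ.real (O₂ ∩ B₂ ∩ D) + μ.real ((O₁ ∪ O₂) ∩ (B₁ ∩ B₂)) ≤ μ.real Ob := by
    have hd12 : Disjoint (O₁ ∩ B₁ ∩ D) (O₂ ∩ B₂ ∩ D) := by
      rw [Set.disjoint_left]
      rintro ω ⟨⟨h1, _⟩, hn⟩ ⟨⟨h2, _⟩, _⟩
      exact hn (h1.symm.trans h2)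
    have hd3 : Disjoint (O₁ ∩ B₁ ∩ D ∪ O₂ ∩ B₂ ∩ D) ((O₁ ∪ O₂) ∩ (B₁ ∩ B₂)) := by
      rw [Set.disjoint_left]
      rintro ω hω ⟨_, ⟨hb1, hb2⟩⟩
      rcases hω with ⟨_, hn⟩ | ⟨_, hn⟩ <;> exact hn (hb1.trans hb2.symm)
    rw [← measureReal_union hd12 (hm _), ← measureReal_union hd3 (hm _)]
    exact measureReal_mono (union_subset (union_subset hS1 hS2) hS3)
  -- Harris twice: `μ((O₁∪O₂) ∩ (B₁∩B₂)) ≥ μ(O₁∪O₂) μ(B₁∩B₂)` and `μ((O₁∪O₂) ∩ D) ≤ μ(O₁∪O₂) μ(D)`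
  have hupO : IsUpperSet (O₁ ∪ O₂) := (isUpperSet_openConn o a₁).union (isUpperSet_openConn o a₂)
  have hupB : IsUpperSet (B₁ ∩ B₂) := (isUpperSet_openConn a₁ b).inter (isUpperSet_openConn a₂ b)
  have hloD : IsLowerSet D := by
    intro ω ω' hle hω h
    exact hω (h.mono (openGraph_mono hle))
  have hH1 : μ.real (O₁ ∪ O₂) * μ.real (B₁ ∩ B₂) ≤ μ.real ((O₁ ∪ O₂) ∩ (B₁ ∩ B₂)) :=
    prodBernoulli_harris w hupO hupB (hm _) (hm _)
  have hH2 : μ.real ((O₁ ∪ O₂) ∩ D) ≤ μ.real (O₁ ∪ O₂) * μ.real D :=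
    prodBernoulli_harris_upper_lower w hupO hloD (hm _) (hm _)
  have hOD : μ.real ((O₁ ∪ O₂) ∩ D) = μ.real (D ∩ O₁) + μ.real (D ∩ O₂) := by
    have hd : Disjoint (D ∩ O₁) (D ∩ O₂) := by
      rw [Set.disjoint_left]
      rintro ω ⟨hn, h1⟩ ⟨_, h2⟩
      exact hn (h1.symm.trans h2)
    rw [← measureReal_union hd (hm _)]
    congr 1
    ext ω
    simp only [mem_inter_iff, mem_union]
    tauto
  -- BHK four times, given `D = {a₁ ↮ a₂}` (as in `KNPreFKG.preFKG_pair`)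
  have hD1 : {ω : BondConfig V | ∀ x ∈ ({a₂} : Set V), ¬ (openGraph ω).Reachable a₁ x} = D := by
    ext ω
    simp [hD]
  have hD2 : {ω : BondConfig V | ∀ x ∈ ({a₁} : Set V), ¬ (openGraph ω).Reachable a₂ x} = D := by
    ext ω
    simp only [mem_setOf_eq, mem_singleton_iff, forall_eq, hD]
    exact not_congr ⟨SimpleGraph.Reachable.symm, SimpleGraph.Reachable.symm⟩
  have hD3 : {ω : BondConfig V | ¬ (openGraph ω).Reachable a₂ a₁} = D := by
    ext ω
    simp only [mem_setOf_eq, hD]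
    exact not_congr ⟨SimpleGraph.Reachable.symm, SimpleGraph.Reachable.symm⟩
  -- (i) `μ(D ∩ O₂) μ(D ∩ B₂) ≤ μ(D) μ(O₂ ∩ B₂ ∩ D)`
  have h_i := bhk_one_upper_upper w a₂ ({a₁} : Set V) (by simpa using Ne.symm h12eq)
    (isUpperSet_connFamily a₂ o) (isUpperSet_connFamily a₂ b)
  rw [hD2, ← openConn_eq_setOf_connFamily, ← openConn_eq_setOf_connFamily, openConn_symm a₂ o] at h_i
  -- (ii) `μ(D) μ(O₂ ∩ B₁ ∩ D) ≤ μ(D ∩ O₂) μ(D ∩ B₁)`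
  have h_ii := bhk_two_upper_upper w a₂ a₁ (Ne.symm h12eq) (isUpperSet_connFamily a₂ o)
    (isUpperSet_connFamily a₁ b)
  rw [hD3, ← openConn_eq_setOf_connFamily, ← openConn_eq_setOf_connFamily, openConn_symm a₂ o] at h_ii
  -- (iii) `μ(D ∩ O₁) μ(D ∩ B₁) ≤ μ(D) μ(O₁ ∩ B₁ ∩ D)`
  have h_iii := bhk_one_upper_upper w a₁ ({a₂} : Set V) (by simpa using h12eq)
    (isUpperSet_connFamily a₁ o) (isUpperSet_connFamily a₁ b)
  rw [hD1, ← openConn_eq_setOf_connFamily, ← openConn_eq_setOf_connFamily, openConn_symm a₁ o] at h_iii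
  -- (iv) `μ(D) μ(O₁ ∩ B₂ ∩ D) ≤ μ(D ∩ O₁) μ(D ∩ B₂)`
  have h_iv := bhk_two_upper_upper w a₁ a₂ h12eq (isUpperSet_connFamily a₁ o)
    (isUpperSet_connFamily a₂ b)
  rw [← openConn_eq_setOf_connFamily, ← openConn_eq_setOf_connFamily, openConn_symm a₁ o] at h_iv
  have e1 : D ∩ (O₂ ∩ B₂) = O₂ ∩ B₂ ∩ D := inter_comm _ _
  have e2 : D ∩ (O₂ ∩ B₁) = O₂ ∩ B₁ ∩ D := inter_comm _ _
  have e3 : D ∩ (O₁ ∩ B₁) = O₁ ∩ B₁ ∩ D := inter_comm _ _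
  have e4 : D ∩ (O₁ ∩ B₂) = O₁ ∩ B₂ ∩ D := inter_comm _ _
  simp only [← hD, ← hO₁, ← hO₂, ← hB₁, ← hB₂] at h_i h_ii h_iii h_iv
  rw [e1] at h_i
  rw [e2] at h_ii
  rw [e3] at h_iii
  rw [e4] at h_iv
  -- combine: `π₂₁ = μ(D ∩ B₁) = μ(B₂ᶜ ∩ B₁)`
  have hpi2' : (B₂ᶜ ∩ B₁) = D ∩ B₁ := by rw [Set.inter_comm]; exact hpi2
  rw [hGain_eq, hpi1, hpi2']
  have hA1 : 0 ≤ μ.real (D ∩ O₁) := measureReal_nonneg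
  have hA2 : 0 ≤ μ.real (D ∩ O₂) := measureReal_nonneg
  have hc : 0 ≤ μ.real (B₁ ∩ B₂) := measureReal_nonneg
  have hp1 : 0 ≤ μ.real (D ∩ B₂) := measureReal_nonneg
  have hp2 : 0 ≤ μ.real (D ∩ B₁) := measureReal_nonneg
  by_cases hD0 : μ.real D = 0
  · have hz : ∀ A : Set (BondConfig V), μ.real (D ∩ A) = 0 := fun A =>
      le_antisymm ((measureReal_mono inter_subset_left).trans hD0.le) measureReal_nonneg
    rw [hz, hz]
    simp only [zero_mul, add_zero]
    exact le_refl 0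
  · have hDpos : 0 < μ.real D := lt_of_le_of_ne measureReal_nonneg (Ne.symm hD0)
    -- `d · Gain ≤ A₁ π₁₂ + A₂ π₂₁`
    have hgain : μ.real D * (μ.real (O₁ ∩ B₂ ∩ D) + μ.real (O₂ ∩ B₁ ∩ D)) ≤
        μ.real (D ∩ O₁) * μ.real (D ∩ B₂) + μ.real (D ∩ O₂) * μ.real (D ∩ B₁) := by
      nlinarith [h_iv, h_ii]
    -- `A₁ h(a₁) + A₂ h(a₂) ≤ d · h(o)`
    have hob : μ.real (D ∩ O₁) * μ.real (D ∩ B₁) + μ.real (D ∩ O₂) * μ.real (D ∩ B₂) +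
        (μ.real (D ∩ O₁) + μ.real (D ∩ O₂)) * μ.real (B₁ ∩ B₂) ≤ μ.real D * μ.real Ob := by
      have h3 : (μ.real (D ∩ O₁) + μ.real (D ∩ O₂)) * μ.real (B₁ ∩ B₂) ≤
          μ.real D * μ.real ((O₁ ∪ O₂) ∩ (B₁ ∩ B₂)) := by
        rw [← hOD]
        calc μ.real ((O₁ ∪ O₂) ∩ D) * μ.real (B₁ ∩ B₂)
            ≤ μ.real (O₁ ∪ O₂) * μ.real D * μ.real (B₁ ∩ B₂) := by
              exact mul_le_mul_of_nonneg_right hH2 hc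
          _ = μ.real D * (μ.real (O₁ ∪ O₂) * μ.real (B₁ ∩ B₂)) := by ring
          _ ≤ μ.real D * μ.real ((O₁ ∪ O₂) ∩ (B₁ ∩ B₂)) := mul_le_mul_of_nonneg_left hH1 hDpos.le
      nlinarith [h_iii, h_i, h3, mul_le_mul_of_nonneg_left hOb_ge hDpos.le]
    have hob' : μ.real (D ∩ O₁) * μ.real B₁ + μ.real (D ∩ O₂) * μ.real B₂ ≤ μ.real D * μ.real Ob := by
      rw [hθ1, hθ2]; nlinarith [hob]
    have hW : 0 ≤ μ.real (D ∩ O₁) * μ.real B₁ + μ.real (D ∩ O₂) * μ.real B₂ :=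
      add_nonneg (mul_nonneg hA1 measureReal_nonneg) (mul_nonneg hA2 measureReal_nonneg)
    have key : μ.real D * ((μ.real (D ∩ O₁) * μ.real B₁ + μ.real (D ∩ O₂) * μ.real B₂) *
        (μ.real (O₁ ∩ B₂ ∩ D) + μ.real (O₂ ∩ B₁ ∩ D))) ≤
        μ.real D * ((μ.real (D ∩ O₁) * μ.real (D ∩ B₂) + μ.real (D ∩ O₂) * μ.real (D ∩ B₁)) * μ.real Ob) := by
      have e1 : μ.real D * ((μ.real (D ∩ O₁) * μ.real B₁ + μ.real (D ∩ O₂) * μ.real B₂) *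
          (μ.real (O₁ ∩ B₂ ∩ D) + μ.real (O₂ ∩ B₁ ∩ D))) =
          (μ.real (D ∩ O₁) * μ.real B₁ + μ.real (D ∩ O₂) * μ.real B₂) *
            (μ.real D * (μ.real (O₁ ∩ B₂ ∩ D) + μ.real (O₂ ∩ B₁ ∩ D))) := by ring
      rw [e1]
      calc (μ.real (D ∩ O₁) * μ.real B₁ + μ.real (D ∩ O₂) * μ.real B₂) *
            (μ.real D * (μ.real (O₁ ∩ B₂ ∩ D) + μ.real (O₂ ∩ B₁ ∩ D)))
          ≤ (μ.real (D ∩ O₁) * μ.real B₁ + μ.real (D ∩ O₂) * μ.real B₂) *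
            (μ.real (D ∩ O₁) * μ.real (D ∩ B₂) + μ.real (D ∩ O₂) * μ.real (D ∩ B₁)) :=
            mul_le_mul_of_nonneg_left hgain hW
        _ ≤ (μ.real D * μ.real Ob) *
            (μ.real (D ∩ O₁) * μ.real (D ∩ B₂) + μ.real (D ∩ O₂) * μ.real (D ∩ B₁)) :=
            mul_le_mul_of_nonneg_right hob' (add_nonneg (mul_nonneg hA1 hp1) (mul_nonneg hA2 hp2))
        _ = μ.real D * ((μ.real (D ∩ O₁) * μ.real (D ∩ B₂) + μ.real (D ∩ O₂) * μ.real (D ∩ B₁)) * μ.real Ob) := by ring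
    exact le_of_mul_le_mul_left key hDpos


end

end Summit.CriticalPhenomena.PercolationContinuityZ3.Theorems
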